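import Summits.Ventures.PercRepro.ProfilePointedCircuitClassesStarSharpD0G

/-!
# PercRepro — CASE D0 OF `StarNineSharp`, PART H: RULES R3 AND R4b
(p5, gen 54; `proofs/P5-GM1.md` §81 (c))

The injections of rule R3 (`d0_injR3`: demands off `H` with ON complement go to `{e, f, x} + b`, OFF, with D0B's
point) and of rule R4b (`d0_injR4b`: residual demands in `H` without the triple target go to `{e, f, x} + b`, ON,
with D0E's C-point; injective by D0F's `r4_unique`).
-/

open scoped Matroid

namespace PercRepro.Cogirth

open Finset ThmH Skew Shadow Profile

open Classical

variable {α : Type} [DecidableEq α] {N : Matroid α} [N.Finite]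

section StarSharpD0H

variable {b b' : α}

/-- **RULE R3.** -/
theorem d0_injR3 (hn : (gr N).card = 9) (hR : rk N (gr N) = 5)
    (_hcf : ∀ x ∈ gr N, rk N ((gr N).erase x) = 5) (h : SeriesPair N b b')
    {e f : α} (he : e ∈ gr N) (hf : f ∈ gr N) (hef : e ≠ f) (heb : e ≠ b) (heb' : e ≠ b') (hfb : f ≠ b) (hfb' : f ≠ b')
    (hE7 : rk N (((gr N).erase b).erase b') = 4)
    (hnl : ∀ S : Finset α, S ⊆ ((gr N).erase b).erase b' → rk N (insert b (insert b' S)) ≤ 3 → rk N S ≤ 1)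
    (he1 : ∀ y ∈ ((((gr N).erase b).erase b').erase f).erase e, rk N {e, y} = 2)
    (hf1 : ∀ y ∈ ((((gr N).erase b).erase b').erase f).erase e, rk N {f, y} = 2)
    (hef2 : rk N {e, f} = 2) (hX : rk N (((((gr N).erase b).erase b').erase f).erase e) = 4)
    {H : Finset α} (hH : H ⊆ ((gr N).erase b).erase b') (heH : e ∈ H) (hfH : f ∈ H) (hH3 : rk N H = 3)
    (hHon : rk N (insert b (insert b' H)) = 4)
    (hHfl : ∀ z ∈ ((gr N).erase b).erase b', z ∉ H → rk N (insert z H) = 4)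
    {w₀ : α} (hw₀ : w₀ ∈ ((((gr N).erase b).erase b').erase f).erase e) (_hw₀H : w₀ ∉ H) :
    ((d0DON N b' e f).filter (fun W => d0c1 N b e f W ∧ ¬ d0c2 N b b' e f W)).card ≤
      ((biIndepSets N 4).filter (fun W => (f ∈ W ∧ b' ∉ W) ∧ (e ∈ W ∧ b ∈ W ∧ (gr N \ W).erase b' ∈ biIndepSets N 4))).card := by
  classical
  have hb : b ∈ gr N := h.1; have hb' : b' ∈ gr N := h.2.1; have hbb' : b ≠ b' := h.2.2.1
  have hXE : ((((gr N).erase b).erase b').erase f).erase e ⊆ ((gr N).erase b).erase b' :=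
    (erase_subset _ _).trans (erase_subset _ _)
  have heE : e ∈ ((gr N).erase b).erase b' := mem_erase.2 ⟨heb', mem_erase.2 ⟨heb, he⟩⟩
  have hfE : f ∈ ((gr N).erase b).erase b' := mem_erase.2 ⟨hfb', mem_erase.2 ⟨hfb, hf⟩⟩
  have hE7c : (((gr N).erase b).erase b').card = 7 := by
    rw [card_erase_of_mem (mem_erase.2 ⟨hbb'.symm, hb'⟩), card_erase_of_mem hb, hn]
  have hXc : (((((gr N).erase b).erase b').erase f).erase e).card = 5 := by
    rw [card_erase_of_mem (mem_erase.2 ⟨hef, heE⟩), card_erase_of_mem hfE, hE7c]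
  have heX : e ∉ ((((gr N).erase b).erase b').erase f).erase e := fun h' => (mem_erase.1 h').1 rfl
  have hfX : f ∉ ((((gr N).erase b).erase b').erase f).erase e := fun h' => (mem_erase.1 (mem_erase.1 h').2).1 rfl
  have hw₀E : w₀ ∈ ((gr N).erase b).erase b' := hXE hw₀
  have hdata := d0_demand_data h hn hf hef heb hfb hfb' (e := e)
  have hclass := d0_demand_class h hR hE7 hnl he hf hef heb heb' hfb hfb' hef2 hH heH hfH hH3 hHon hHfl
  have hS3 := d0_S3 h hn he hf hef heb heb' hfb hfb'
  set X := ((((gr N).erase b).erase b').erase f).erase e with hXdef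
  apply card_le_card_of_injOn (fun W => insert b {e, f,
    (if h : ∃ x ∈ (W.erase b).erase e, rk N {e, f, x} = 3 ∧ rk N (X.erase x) = 4 ∧
      rk N (insert b (insert b' {e, f, x})) = 5 then h.choose else e)})
  · intro W hW
    simp only [d0DON, mem_coe, mem_filter] at hW
    obtain ⟨⟨hWs, hPD, hcW⟩, hc₁, hnc₂⟩ := hW
    obtain ⟨hbW, hπX, hπ2, hYeq, hWeq, hYr, hYc, hYon⟩ := hdata W hWs hPD hcW
    have hcon := rk_insert_bb'_bounds h (sdiff_subset.trans hXE : X \ (W.erase b).erase e ⊆ _)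
    have hS := hS3 _ hπX hπ2 hYc
    have hcon4 : rk N (insert b (insert b' (X \ (W.erase b).erase e))) = 4 := by
      have : ¬ rk N (insert b (insert b' (X \ (W.erase b).erase e))) = 5 := hnc₂
      omega
    obtain ⟨x, hxπ, hefx, hx4, hx5⟩ := r3_point_exists h hn hR hnl he hf hef heb heb' hfb hfb' he1 hX hπX hπ2
      hYc hYon hc₁ hcon4
    have hex : ∃ x ∈ (W.erase b).erase e, rk N {e, f, x} = 3 ∧ rk N (X.erase x) = 4 ∧
        rk N (insert b (insert b' {e, f, x})) = 5 := ⟨x, hxπ, hefx, hx4, hx5⟩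
    simp only [mem_coe, mem_filter]
    rw [dif_pos hex]
    obtain ⟨hzπ, hefz, hz4, hz5⟩ := hex.choose_spec
    have hzX : hex.choose ∈ X := hπX hzπ
    have hze : hex.choose ≠ e := fun h' => heX (h' ▸ hzX)
    have hzf : hex.choose ≠ f := fun h' => hfX (h' ▸ hzX)
    have hzE := hXE hzX
    have hS : ({e, f, hex.choose} : Finset α) ⊆ ((gr N).erase b).erase b' := by
      intro w hw; simp only [mem_insert, mem_singleton] at hw
      rcases hw with rfl | rfl | rfl <;> assumption
    have hS3' : ({e, f, hex.choose} : Finset α).card = 3 := by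
      rw [card_insert_of_notMem, card_pair hzf.symm]
      simp only [mem_insert, mem_singleton, not_or]; exact ⟨hef, hze.symm⟩
    refine ⟨?_, ⟨mem_insert_of_mem (mem_insert_of_mem (mem_insert_self _ _)), ?_⟩,
      mem_insert_of_mem (mem_insert_self _ _), mem_insert_self _ _, ?_⟩
    · rw [insert_b_mem_biIndepSets_iff h hn hS hS3', E7_sdiff_efx_eq]
      exact ⟨hefz, hz4⟩
    · intro h'
      simp only [mem_insert, mem_singleton] at h'
      rcases h' with h2 | h2 | h2 | h2
      · exact hbb' h2.symm
      · exact heb' h2.symm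
      · exact hfb' h2.symm
      · exact (mem_erase.1 hzE).1 h2.symm
    · rw [off_image_efx_iff h hn he hf hef heb heb' hfb hfb' hzX]
      exact ⟨hz4, hz5⟩
  · intro W₁ hW₁ W₂ hW₂ heq
    simp only [d0DON, mem_coe, mem_filter] at hW₁ hW₂
    obtain ⟨hb₁, hπ₁, hπ2₁, hYeq₁, hWeq₁, -, hYc₁, hYon₁⟩ := hdata W₁ hW₁.1.1 hW₁.1.2.1 hW₁.1.2.2
    obtain ⟨hb₂, hπ₂, hπ2₂, hYeq₂, hWeq₂, -, hYc₂, hYon₂⟩ := hdata W₂ hW₂.1.1 hW₂.1.2.1 hW₂.1.2.2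
    have hcon₁ : rk N (insert b (insert b' (X \ (W₁.erase b).erase e))) = 4 := by
      have := rk_insert_bb'_bounds h (sdiff_subset.trans hXE : X \ (W₁.erase b).erase e ⊆ _)
      have hS := hS3 _ hπ₁ hπ2₁ hYc₁
      have : ¬ rk N (insert b (insert b' (X \ (W₁.erase b).erase e))) = 5 := hW₁.2.2
      omega
    have hcon₂ : rk N (insert b (insert b' (X \ (W₂.erase b).erase e))) = 4 := by
      have := rk_insert_bb'_bounds h (sdiff_subset.trans hXE : X \ (W₂.erase b).erase e ⊆ _)
      have hS := hS3 _ hπ₂ hπ2₂ hYc₂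
      have : ¬ rk N (insert b (insert b' (X \ (W₂.erase b).erase e))) = 5 := hW₂.2.2
      omega
    obtain ⟨x₁, hx₁, hefx₁, hx4₁, hx5₁⟩ := r3_point_exists h hn hR hnl he hf hef heb heb' hfb hfb' he1 hX hπ₁ hπ2₁
      hYc₁ hYon₁ hW₁.2.1 hcon₁
    obtain ⟨x₂, hx₂, hefx₂, hx4₂, hx5₂⟩ := r3_point_exists h hn hR hnl he hf hef heb heb' hfb hfb' he1 hX hπ₂ hπ2₂
      hYc₂ hYon₂ hW₂.2.1 hcon₂
    have hex₁ : ∃ x ∈ (W₁.erase b).erase e, rk N {e, f, x} = 3 ∧ rk N (X.erase x) = 4 ∧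
        rk N (insert b (insert b' {e, f, x})) = 5 := ⟨x₁, hx₁, hefx₁, hx4₁, hx5₁⟩
    have hex₂ : ∃ x ∈ (W₂.erase b).erase e, rk N {e, f, x} = 3 ∧ rk N (X.erase x) = 4 ∧
        rk N (insert b (insert b' {e, f, x})) = 5 := ⟨x₂, hx₂, hefx₂, hx4₂, hx5₂⟩
    simp only at heq
    rw [dif_pos hex₁, dif_pos hex₂] at heq
    obtain ⟨hz₁, -, hz4₁, -⟩ := hex₁.choose_spec
    obtain ⟨hz₂, -, -, -⟩ := hex₂.choose_spec
    set z₁ := hex₁.choose with hz₁def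
    set z₂ := hex₂.choose with hz₂def
    have hz₁X : z₁ ∈ X := hπ₁ hz₁
    have hz₁e : z₁ ≠ e := fun h' => heX (h' ▸ hz₁X)
    have hz₁f : z₁ ≠ f := fun h' => hfX (h' ▸ hz₁X)
    have hz₁b : z₁ ≠ b := fun h' => (mem_erase.1 (mem_erase.1 (hXE hz₁X)).2).1 h'
    have hzz : z₁ = z₂ := by
      have : z₁ ∈ insert b ({e, f, z₂} : Finset α) := by
        rw [← heq]; exact mem_insert_of_mem (mem_insert_of_mem (mem_insert_of_mem (mem_singleton_self _)))
      simp only [mem_insert, mem_singleton] at this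
      rcases this with h' | h' | h' | h'
      · exact absurd h' hz₁b
      · exact absurd h' hz₁e
      · exact absurd h' hz₁f
      · exact h'
    by_cases hππ : (W₁.erase b).erase e = (W₂.erase b).erase e
    · rw [← hWeq₁, ← hWeq₂, ← hYeq₁, ← hYeq₂, hππ]
    · exfalso
      have hc₁' : (((W₁.erase b).erase e).erase z₁).card = 1 := by rw [card_erase_of_mem hz₁, hπ2₁]
      have hc₂' : (((W₂.erase b).erase e).erase z₂).card = 1 := by rw [card_erase_of_mem hz₂, hπ2₂]
      obtain ⟨y₁, hy₁⟩ := card_eq_one.1 hc₁'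
      obtain ⟨y₂, hy₂⟩ := card_eq_one.1 hc₂'
      have eπ₁ : (W₁.erase b).erase e = {z₁, y₁} := by rw [← insert_erase hz₁, hy₁]
      have eπ₂ : (W₂.erase b).erase e = {z₂, y₂} := by rw [← insert_erase hz₂, hy₂]
      have hy₁X : y₁ ∈ X := hπ₁ (by rw [eπ₁]; exact mem_insert_of_mem (mem_singleton_self _))
      have hy₂X : y₂ ∈ X := hπ₂ (by rw [eπ₂]; exact mem_insert_of_mem (mem_singleton_self _))
      have hyy : y₁ ≠ y₂ := by
        intro hyy; apply hππ; rw [eπ₁, eπ₂, hzz, hyy]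
      rw [eπ₁] at hcon₁
      rw [eπ₂, ← hzz] at hcon₂
      exact r3_injective h hR hnl hyy hy₁X hy₂X hcon₁ hcon₂ hz4₁

/-- **RULE R4b.** -/
theorem d0_injR4b (hn : (gr N).card = 9) (hR : rk N (gr N) = 5)
    (hcf : ∀ x ∈ gr N, rk N ((gr N).erase x) = 5) (h : SeriesPair N b b')
    {e f : α} (he : e ∈ gr N) (hf : f ∈ gr N) (hef : e ≠ f) (heb : e ≠ b) (heb' : e ≠ b') (hfb : f ≠ b) (hfb' : f ≠ b')
    (hE7 : rk N (((gr N).erase b).erase b') = 4)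
    (hnl : ∀ S : Finset α, S ⊆ ((gr N).erase b).erase b' → rk N (insert b (insert b' S)) ≤ 3 → rk N S ≤ 1)
    (he1 : ∀ y ∈ ((((gr N).erase b).erase b').erase f).erase e, rk N {e, y} = 2)
    (hf1 : ∀ y ∈ ((((gr N).erase b).erase b').erase f).erase e, rk N {f, y} = 2)
    (hef2 : rk N {e, f} = 2) (hX : rk N (((((gr N).erase b).erase b').erase f).erase e) = 4)
    {H : Finset α} (hH : H ⊆ ((gr N).erase b).erase b') (heH : e ∈ H) (hfH : f ∈ H) (hH3 : rk N H = 3)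
    (hHon : rk N (insert b (insert b' H)) = 4)
    (hHfl : ∀ z ∈ ((gr N).erase b).erase b', z ∉ H → rk N (insert z H) = 4)
    {w₀ : α} (hw₀ : w₀ ∈ ((((gr N).erase b).erase b').erase f).erase e) (hw₀H : w₀ ∉ H) :
    ((d0DON N b' e f).filter (fun W => (¬ d0c1 N b e f W ∧ ¬ d0c3 N b b' e f W) ∧ ¬ d0c4 N b b' e f w₀ W)).card ≤
      ((biIndepSets N 4).filter (fun W => (f ∈ W ∧ b' ∉ W) ∧ (e ∈ W ∧ b ∈ W ∧ ¬ (gr N \ W).erase b' ∈ biIndepSets N 4))).card := by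
  classical
  have hb : b ∈ gr N := h.1; have hb' : b' ∈ gr N := h.2.1; have hbb' : b ≠ b' := h.2.2.1
  have hXE : ((((gr N).erase b).erase b').erase f).erase e ⊆ ((gr N).erase b).erase b' :=
    (erase_subset _ _).trans (erase_subset _ _)
  have heE : e ∈ ((gr N).erase b).erase b' := mem_erase.2 ⟨heb', mem_erase.2 ⟨heb, he⟩⟩
  have hfE : f ∈ ((gr N).erase b).erase b' := mem_erase.2 ⟨hfb', mem_erase.2 ⟨hfb, hf⟩⟩
  have hE7c : (((gr N).erase b).erase b').card = 7 := by
    rw [card_erase_of_mem (mem_erase.2 ⟨hbb'.symm, hb'⟩), card_erase_of_mem hb, hn]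
  have hXc : (((((gr N).erase b).erase b').erase f).erase e).card = 5 := by
    rw [card_erase_of_mem (mem_erase.2 ⟨hef, heE⟩), card_erase_of_mem hfE, hE7c]
  have heX : e ∉ ((((gr N).erase b).erase b').erase f).erase e := fun h' => (mem_erase.1 h').1 rfl
  have hfX : f ∉ ((((gr N).erase b).erase b').erase f).erase e := fun h' => (mem_erase.1 (mem_erase.1 h').2).1 rfl
  have hw₀E : w₀ ∈ ((gr N).erase b).erase b' := hXE hw₀
  have hdata := d0_demand_data h hn hf hef heb hfb hfb' (e := e)
  have hclass := d0_demand_class h hR hE7 hnl he hf hef heb heb' hfb hfb' hef2 hH heH hfH hH3 hHon hHfl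
  have hS3 := d0_S3 h hn he hf hef heb heb' hfb hfb'
  set X := ((((gr N).erase b).erase b').erase f).erase e with hXdef
  apply card_le_card_of_injOn (fun W => insert b {e, f,
    (if h : ∃ x ∈ (W.erase b).erase e, rk N {e, f, x} = 3 ∧ rk N (X.erase x) = 4 then h.choose else e)})
  · intro W hW
    simp only [d0DON, mem_coe, mem_filter] at hW
    obtain ⟨⟨hWs, hPD, hcW⟩, ⟨hnc₁, hnc₃⟩, -⟩ := hW
    obtain ⟨hbW, hπX, hπ2, hYeq, hWeq, hYr, hYc, hYon⟩ := hdata W hWs hPD hcW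
    obtain ⟨hfY3, hπH⟩ := hclass _ hπX hπ2 hYr hYon hnc₁
    obtain ⟨x, hxπ, hefx, hx4⟩ := c_point_exists h hn he hf hef heb heb' hfb hfb' hef2 he1 hf1 hX hπX hπ2 hYr hYc hnc₃
    have hex : ∃ x ∈ (W.erase b).erase e, rk N {e, f, x} = 3 ∧ rk N (X.erase x) = 4 := ⟨x, hxπ, hefx, hx4⟩
    simp only [mem_coe, mem_filter]
    rw [dif_pos hex]
    obtain ⟨hzπ, hefz, hz4⟩ := hex.choose_spec
    set z := hex.choose with hzdef
    have hzX : z ∈ X := hπX hzπ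
    have hze : z ≠ e := fun h' => heX (h' ▸ hzX)
    have hzf : z ≠ f := fun h' => hfX (h' ▸ hzX)
    have hzE := hXE hzX
    have hS : ({e, f, z} : Finset α) ⊆ ((gr N).erase b).erase b' := by
      intro w hw; simp only [mem_insert, mem_singleton] at hw
      rcases hw with rfl | rfl | rfl <;> assumption
    have hSH : ({e, f, z} : Finset α) ⊆ H := by
      intro w hw; simp only [mem_insert, mem_singleton] at hw
      rcases hw with rfl | rfl | rfl
      · exact heH
      · exact hfH
      · exact hπH (mem_insert_of_mem hzπ)
    have hS3' : ({e, f, z} : Finset α).card = 3 := by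
      rw [card_insert_of_notMem, card_pair hzf.symm]
      simp only [mem_insert, mem_singleton, not_or]; exact ⟨hef, hze.symm⟩
    have hon : rk N (insert b (insert b' {e, f, z})) = 4 := by
      have h1 : rk N (insert b (insert b' {e, f, z})) ≤ rk N (insert b (insert b' H)) :=
        rk_mono' (M := N) (insert_subset_insert b (insert_subset_insert b' hSH))
      have h2 := rk_insert_bb'_bounds h hS
      omega
    refine ⟨?_, ⟨mem_insert_of_mem (mem_insert_of_mem (mem_insert_self _ _)), ?_⟩,
      mem_insert_of_mem (mem_insert_self _ _), mem_insert_self _ _, ?_⟩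
    · rw [insert_b_mem_biIndepSets_iff h hn hS hS3', E7_sdiff_efx_eq]
      exact ⟨hefz, hz4⟩
    · intro h'
      simp only [mem_insert, mem_singleton] at h'
      rcases h' with h2 | h2 | h2 | h2
      · exact hbb' h2.symm
      · exact heb' h2.symm
      · exact hfb' h2.symm
      · exact (mem_erase.1 hzE).1 h2.symm
    · rw [off_image_efx_iff h hn he hf hef heb heb' hfb hfb' hzX]
      rintro ⟨-, h5⟩
      omega
  · intro W₁ hW₁ W₂ hW₂ heq
    simp only [d0DON, mem_coe, mem_filter] at hW₁ hW₂
    obtain ⟨hb₁, hπ₁, hπ2₁, hYeq₁, hWeq₁, hYr₁, hYc₁, hYon₁⟩ := hdata W₁ hW₁.1.1 hW₁.1.2.1 hW₁.1.2.2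
    obtain ⟨hb₂, hπ₂, hπ2₂, hYeq₂, hWeq₂, hYr₂, hYc₂, hYon₂⟩ := hdata W₂ hW₂.1.1 hW₂.1.2.1 hW₂.1.2.2
    obtain ⟨-, hπH₁⟩ := hclass _ hπ₁ hπ2₁ hYr₁ hYon₁ hW₁.2.1.1
    obtain ⟨-, hπH₂⟩ := hclass _ hπ₂ hπ2₂ hYr₂ hYon₂ hW₂.2.1.1
    by_cases hππ : (W₁.erase b).erase e = (W₂.erase b).erase e
    · rw [← hWeq₁, ← hWeq₂, ← hYeq₁, ← hYeq₂, hππ]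
    · exfalso
      exact r4_unique h hn hR hcf hE7 hnl he hf hef heb heb' hfb hfb' hef2 he1 hf1 hH heH hfH hH3 hHon hHfl hw₀ hw₀H
        hππ hπ₁ hπ2₁ hπH₁ hπ₂ hπ2₂ hπH₂ hYc₁ hYc₂ hW₁.2.1.2 hW₂.2.1.2 hW₁.2.2 hW₂.2.2

end StarSharpD0H

end PercRepro.Cogirth
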